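import Summits.AtomisticToContinuum.Crystallization.Theses.DisclinationRation
import Summits.AtomisticToContinuum.Crystallization.Theorems.PhononStability.Negative.Mirror

/-!
# `UniformPolytypeStability` (stmt-AtomisticToContinuum-15800), negative side I: mirror, window form, lattice witnesses

Route `DisclinationRation`, crux `UniformPolytypeStability` (K4, rank 5): ONE `κ > 0` such that for
every in-layer spacing `a ∈ [47/50, 1]`, every Hägg word `s` and every height sequence `z` with
increments in `[39a/50, 17a/20]` whose layered set `L(a,s,z)` is in exact Lennard-Jones force
balance, `κ·Σ_{|p−q|≤11/10}‖u_p−u_q‖² ≤ ½Σ_{p≠q} (u_p−u_q)ᵀK(p−q)(u_p−u_q)` for every finitely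
supported displacement `u`.  This file (part I of the standing disprover's load-bearing analysis)
names the crux's `let`-bound objects (`Sites`, `HeightBox`, `ForceBalanced`, `nnForm`, `hessForm`;
`Hess₀` is the landed mirror of `let Hess` from `PhononStability/Negative/Mirror.lean`), records
`uniformPolytypeStability_iff` (`Iff.rfl`) and the WINDOW form `UniformPolytypeStabilityOn W`
(the crux is `W = Box`, i.e. `47/50 ≤ a ∧ a ≤ 1 ∧ IsHaggSeq s ∧ HeightBox a z`; the mutated
statements of the later parts drop one conjunct of `Box`), and proves the two structural facts the
whole analysis rests on:
* `sites_const_zU` — for the fcc word `constHagg` and UNIFORM heights `z m = h·m` the site set is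
  the Bravais lattice `fccLat = ℤu_a + ℤv_a + ℤ(w_a + h e₃)` (the tree's `barlowPeriodLattice`
  of period `1`);
* `forceBalanced_of_sites_eq` — every layered set that is (as a set) a full-rank discrete
  `ℤ`-submodule is in exact force balance: the force rows are absolutely summable (`|V′(r)| ≤
  r⁻¹³ + r⁻⁷`, Mathlib `ZLattice.summable_norm_sub_inv_pow`) and odd under the point reflection
  `q ↦ 2p − q`.  CONSEQUENCE (read by the provers): force balance does NOT pin the layer spacing —
  `L(a, constHagg, h·m)` is force balanced for EVERY `a, h ≠ 0`, so the crux's family contains the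
  whole two-parameter homogeneous-strain box `a ∈ [47/50,1] × h/a ∈ [39/50, 17/20]` of fcc (and,
  by the basal mirror, of hcp), not only in-plane prestress.
Finally `hessForm_single` gives the row structure of the second variation of a single-site
displacement `ξ·𝟙_{0}` on such a lattice: `hessForm = 2·Σ'_{y ≠ 0} ξᵀK(y)ξ`.  All `[folklore]`.
-/

noncomputable section

namespace Summit.AtomisticToContinuum.Crystallization.Theorems.UniformPolytypeStabilityNegative

open scoped BigOperators Topology Classical InnerProductSpace
open Filter Set Function
open Literature.MathematicalPhysics.StatisticalMechanics
open Summit.AtomisticToContinuum.Crystallization.Theorems.PhononStabilityNegative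

local notation "E3" => EuclideanSpace ℝ (Fin 3)

/-! ## §0 Mirror of the crux's local objects (verbatim; all unfold definitionally) -/

/-- The layered site set `L(a,s,z)`: triangular layers of spacing `a`, layer `m` in hole registry
`haggLabel s m`, at height `z m` (verbatim the crux's `let Sites`). [folklore] -/
def Sites (a : ℝ) (s : ℤ → ℤ) (z : ℤ → ℝ) : Set E3 :=
  {p | ∃ m i j : ℤ, p = ((i : ℝ) • triangularVec₁ a) + ((j : ℝ) • triangularVec₂ a) +
    ((haggLabel s m : ℝ) • barlowOffset a) + (z m • layerNormal 1)}

/-- The height box: increments in `[39a/50, 17a/20]` (verbatim the crux's hypothesis). [folklore] -/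
def HeightBox (a : ℝ) (z : ℤ → ℝ) : Prop :=
  ∀ m : ℤ, 39 / 50 * a ≤ z (m + 1) - z m ∧ z (m + 1) - z m ≤ 17 / 20 * a

/-- Exact Lennard-Jones force balance of `L(a,s,z)` (verbatim the crux's hypothesis). [folklore] -/
def ForceBalanced (a : ℝ) (s : ℤ → ℤ) (z : ℤ → ℝ) : Prop :=
  ∀ p ∈ Sites a s z, HasSum (fun q : {q : E3 // q ∈ Sites a s z ∧ q ≠ p} =>
    (deriv lennardJones (dist p q.1) / dist p q.1) • (p - q.1)) 0

/-- Nearest-neighbour strain form (the crux's left-hand double `tsum`). [folklore] -/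
def nnForm (a : ℝ) (s : ℤ → ℤ) (z : ℤ → ℝ) (u : E3 → E3) : ℝ :=
  ∑' p : Sites a s z, ∑' q : Sites a s z, if dist (p : E3) q ≤ 11 / 10 then ‖u p - u q‖ ^ 2 else 0

/-- Second-variation double sum (the crux's right-hand double `tsum`, before halving). [folklore] -/
def hessForm (a : ℝ) (s : ℤ → ℤ) (z : ℤ → ℝ) (u : E3 → E3) : ℝ :=
  ∑' p : Sites a s z, ∑' q : Sites a s z,
    if (p : E3) ≠ q then Hess₀ ((p : E3) - q) (u p - u q) else 0

/-- The crux over the named objects (definitional unfolding only). [folklore] -/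
theorem uniformPolytypeStability_iff :
    Summit.AtomisticToContinuum.Crystallization.Theses.DisclinationRation.UniformPolytypeStability ↔
      ∃ κ : ℝ, 0 < κ ∧ ∀ (a : ℝ) (s : ℤ → ℤ) (z : ℤ → ℝ), 47 / 50 ≤ a → a ≤ 1 → IsHaggSeq s →
        HeightBox a z → ForceBalanced a s z →
        ∀ u : E3 → E3, (Function.support u).Finite → Function.support u ⊆ Sites a s z →
          κ * nnForm a s z u ≤ hessForm a s z u / 2 :=
  Iff.rfl

/-! ## §1 The window form (the mutated statements drop one conjunct of `Box`) -/

/-- **Uniform polytype stability on a window predicate** `W a s z` replacing the crux's four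
geometric hypotheses `47/50 ≤ a`, `a ≤ 1`, `IsHaggSeq s`, `HeightBox a z` (force balance is kept).
[folklore] -/
def UniformPolytypeStabilityOn (W : ℝ → (ℤ → ℤ) → (ℤ → ℝ) → Prop) : Prop :=
  ∃ κ : ℝ, 0 < κ ∧ ∀ (a : ℝ) (s : ℤ → ℤ) (z : ℤ → ℝ), W a s z → ForceBalanced a s z →
    ∀ u : E3 → E3, (Function.support u).Finite → Function.support u ⊆ Sites a s z →
      κ * nnForm a s z u ≤ hessForm a s z u / 2

/-- The crux's window: `47/50 ≤ a ≤ 1`, `s` a Hägg word, increments of `z` in `[39a/50, 17a/20]`.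
[folklore] -/
def Box (a : ℝ) (s : ℤ → ℤ) (z : ℤ → ℝ) : Prop :=
  47 / 50 ≤ a ∧ a ≤ 1 ∧ IsHaggSeq s ∧ HeightBox a z

/-- The crux is stability on the window `Box`. [folklore] -/
theorem uniformPolytypeStability_iff_on :
    Summit.AtomisticToContinuum.Crystallization.Theses.DisclinationRation.UniformPolytypeStability ↔
      UniformPolytypeStabilityOn Box := by
  rw [uniformPolytypeStability_iff]
  unfold UniformPolytypeStabilityOn Box
  constructor
  · rintro ⟨κ, hκ, h⟩
    exact ⟨κ, hκ, fun a s z hW hF => h a s z hW.1 hW.2.1 hW.2.2.1 hW.2.2.2 hF⟩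
  · rintro ⟨κ, hκ, h⟩
    exact ⟨κ, hκ, fun a s z h₁ h₂ h₃ h₄ hF => h a s z ⟨h₁, h₂, h₃, h₄⟩ hF⟩

/-- Stability on a window passes to smaller windows. [folklore] -/
theorem UniformPolytypeStabilityOn.mono {W W' : ℝ → (ℤ → ℤ) → (ℤ → ℝ) → Prop}
    (h : UniformPolytypeStabilityOn W) (hle : ∀ a s z, W' a s z → W a s z) :
    UniformPolytypeStabilityOn W' := by
  unfold UniformPolytypeStabilityOn at *
  obtain ⟨κ, hκ, h⟩ := h
  exact ⟨κ, hκ, fun a s z hW' => h a s z (hle a s z hW')⟩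

/-- The nearest-neighbour strain form is `≥ 0`. [folklore] -/
theorem nnForm_nonneg (a : ℝ) (s : ℤ → ℤ) (z : ℤ → ℝ) (u : E3 → E3) : 0 ≤ nnForm a s z u :=
  tsum_nonneg fun _ => tsum_nonneg fun _ => by split_ifs <;> positivity

/-! ## §2 Uniform heights, the fcc word, and its Bravais lattice -/

/-- Uniform heights `z m = h·m`. [folklore] -/
def zU (h : ℝ) : ℤ → ℝ := fun m => h * m

/-- Uniform increments are `h`. [folklore] -/
theorem zU_succ_sub (h : ℝ) (m : ℤ) : zU h (m + 1) - zU h m = h := by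
  simp only [zU]; push_cast; ring

/-- Uniform heights with `h ∈ [39a/50, 17a/20]` satisfy the height box. [folklore] -/
theorem heightBox_zU {a h : ℝ} (h₁ : 39 / 50 * a ≤ h) (h₂ : h ≤ 17 / 20 * a) :
    HeightBox a (zU h) := fun m => by
  rw [zU_succ_sub]; exact ⟨h₁, h₂⟩

/-- `c • (h e₃) = (c h) e₃`. [folklore] -/
theorem smul_layerNormal (c h : ℝ) : c • layerNormal h = layerNormal (c * h) := by
  ext k; fin_cases k <;> simp [layerNormal]

/-- The fcc Bravais lattice `ℤu_a + ℤv_a + ℤ(w_a + h e₃)` with spacings `a, h` (the tree's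
Barlow period lattice of the constant Hägg word, period `1`). [folklore] -/
def fccLat {a h : ℝ} (ha : a ≠ 0) (hh : h ≠ 0) : Submodule ℤ E3 :=
  barlowPeriodLattice constHagg ha hh one_ne_zero

/-- The fcc lattice is discrete (it is the `ℤ`-span of a basis). [folklore] -/
instance {a h : ℝ} (ha : a ≠ 0) (hh : h ≠ 0) : DiscreteTopology (fccLat ha hh) := by
  unfold fccLat barlowPeriodLattice; infer_instance

/-- The fcc lattice is a full lattice (it is the `ℤ`-span of a basis). [folklore] -/
instance {a h : ℝ} (ha : a ≠ 0) (hh : h ≠ 0) : IsZLattice ℝ (fccLat ha hh) := by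
  unfold fccLat barlowPeriodLattice; infer_instance

/-- `rank fccLat = 3`. [folklore] -/
theorem finrank_fccLat {a h : ℝ} (ha : a ≠ 0) (hh : h ≠ 0) :
    Module.finrank ℤ (fccLat ha hh) = 3 := by
  rw [ZLattice.rank ℝ (fccLat ha hh), finrank_euclideanSpace, Fintype.card_fin]

/-- Membership in the fcc lattice: integer combinations `i u + j v + m w + m h e₃`. [folklore] -/
theorem mem_fccLat_iff {a h : ℝ} (ha : a ≠ 0) (hh : h ≠ 0) (g : E3) :
    g ∈ fccLat ha hh ↔ ∃ m i j : ℤ, g = (i : ℝ) • triangularVec₁ a + (j : ℝ) • triangularVec₂ a +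
      (m : ℝ) • barlowOffset a + (m : ℝ) • layerNormal h := by
  have key : ∀ m : ℤ, (m : ℝ) • ((haggWindow constHagg 0 1 : ℝ) • barlowOffset a +
      ((1 : ℕ) : ℝ) • layerNormal h) = (m : ℝ) • barlowOffset a + (m : ℝ) • layerNormal h := by
    intro m
    rw [haggWindow_const]
    push_cast
    rw [one_smul, one_smul, smul_add]
  constructor
  · intro hg
    obtain ⟨n₀, n₁, n₂, rfl⟩ := exists_eq_of_mem_barlowPeriodLattice constHagg ha hh one_ne_zero hg
    exact ⟨n₂, n₀, n₁, by rw [key]; abel⟩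
  · rintro ⟨m, i, j, rfl⟩
    have := sum_smul_mem_barlowPeriodLattice constHagg ha hh one_ne_zero i j m
    rw [key, ← add_assoc] at this
    exact this

/-- **For the fcc word and uniform heights the site set is the fcc Bravais lattice.** [folklore] -/
theorem sites_const_zU {a h : ℝ} (ha : a ≠ 0) (hh : h ≠ 0) :
    Sites a constHagg (zU h) = (fccLat ha hh : Set E3) := by
  ext g
  rw [SetLike.mem_coe, mem_fccLat_iff]
  simp only [Sites, Set.mem_setOf_eq, haggLabel_const, zU]
  constructor
  · rintro ⟨m, i, j, rfl⟩
    refine ⟨m, i, j, ?_⟩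
    rw [smul_layerNormal, smul_layerNormal, mul_one, mul_comm]
  · rintro ⟨m, i, j, rfl⟩
    refine ⟨m, i, j, ?_⟩
    rw [smul_layerNormal, smul_layerNormal, mul_one, mul_comm]

/-- Lattice vectors are points of the fcc stacking with spacings `a`, `h`. [folklore] -/
theorem mem_fccStacking_of_mem_fccLat {a h : ℝ} (ha : a ≠ 0) (hh : h ≠ 0) {g : E3}
    (hg : g ∈ fccLat ha hh) : g ∈ fccStacking a h := by
  obtain ⟨m, i, j, rfl⟩ := (mem_fccLat_iff ha hh g).1 hg
  exact ⟨m, i, j, by simp [barlowPos]⟩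

/-- Nonzero fcc lattice vectors are long: `‖g‖ ≥ min a h` (`a, h > 0`). [folklore] -/
theorem min_le_norm_of_mem_fccLat {a h : ℝ} (ha : 0 < a) (hh : 0 < h) {g : E3}
    (hg : g ∈ fccLat ha.ne' hh.ne') (hg0 : g ≠ 0) : min a h ≤ ‖g‖ := by
  have h0 : (0 : E3) ∈ fccStacking a h := ⟨0, 0, 0, by simp [barlowPos]⟩
  have := le_dist_of_mem_barlowStacking a h constHagg ha.le hh.le h0
    (mem_fccStacking_of_mem_fccLat ha.ne' hh.ne' hg) hg0.symm
  rwa [dist_eq_norm, zero_sub, norm_neg] at this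

/-! ## §3 Force balance of point-symmetric (Bravais) site sets -/

/-- The force row summand `V′(|p−q|)/|p−q| · (p − q)`. [folklore] -/
def forceTerm (p q : E3) : E3 := (deriv lennardJones (dist p q) / dist p q) • (p - q)

/-- `‖V′(r)/r · (p−q)‖ = |V′(r)| ≤ r⁻¹³ + r⁻⁷`. [folklore] -/
theorem norm_forceTerm_le {p q : E3} (hpq : p ≠ q) :
    ‖forceTerm p q‖ ≤ (dist p q)⁻¹ ^ 13 + (dist p q)⁻¹ ^ 7 := by
  have hd : 0 < dist p q := dist_pos.2 hpq
  rw [forceTerm, norm_smul, ← dist_eq_norm, Real.norm_eq_abs, abs_div, abs_of_pos hd,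
    div_mul_cancel₀ _ hd.ne', deriv_lennardJones hd.ne']
  have hx : 0 ≤ (dist p q)⁻¹ := inv_nonneg.2 hd.le
  refine abs_le.2 ⟨?_, ?_⟩ <;> nlinarith [pow_nonneg hx 13, pow_nonneg hx 7]

/-- The force summand is odd under the point reflection `q ↦ 2p − q`. [folklore] -/
theorem forceTerm_reflect (p q : E3) : forceTerm p ((2 : ℝ) • p - q) = -forceTerm p q := by
  have h1 : dist p ((2 : ℝ) • p - q) = dist p q := by
    rw [dist_eq_norm, dist_eq_norm, two_smul, ← norm_neg (p - q)]
    congr 1; abel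
  have h2 : p - ((2 : ℝ) • p - q) = -(p - q) := by rw [two_smul]; abel
  rw [forceTerm, forceTerm, h1, h2, smul_neg]

/-- In a real vector space `S = −S` forces `S = 0`. [folklore] -/
theorem eq_zero_of_eq_neg_self {S : E3} (h : S = -S) : S = 0 := by
  have h2 : (2 : ℝ) • S = 0 := by
    rw [two_smul]
    nth_rewrite 2 [h]
    exact add_neg_cancel S
  rcases smul_eq_zero.1 h2 with h | h
  · norm_num at h
  · exact h

/-- **Bravais site sets are force balanced.**  If `L(a,s,z)` is, as a set, a discrete `ℤ`-submodule
of rank `3`, then every site is in exact LJ force balance: the force row at `p` is absolutely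
summable (`|V′(r)| ≤ r⁻¹³ + r⁻⁷` over a lattice) and odd under the bijection `q ↦ 2p − q` of the
other sites, hence sums to `0`.  In particular force balance does not constrain `a` or a uniform
spacing `h` at all. [folklore] -/
theorem forceBalanced_of_sites_eq {a : ℝ} {s : ℤ → ℤ} {z : ℤ → ℝ} (L : Submodule ℤ E3)
    [DiscreteTopology L] (hL : Module.finrank ℤ L = 3) (hS : Sites a s z = (L : Set E3)) :
    ForceBalanced a s z := by
  have hSub : ∀ x : E3, x ∈ Sites a s z → x ∈ L := fun x hx => by rw [hS] at hx; exact hx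
  have hSub' : ∀ x : E3, x ∈ L → x ∈ Sites a s z := fun x hx => by rw [hS]; exact hx
  intro p hp
  have hpL : p ∈ L := hSub p hp
  set T := {q : E3 // q ∈ Sites a s z ∧ q ≠ p}
  change HasSum (fun q : T => forceTerm p q.1) 0
  -- absolute summability of the force row
  have hsum : Summable (fun q : T => forceTerm p q.1) := by
    let e : T → L := fun q => ⟨q.1, hSub q.1 q.2.1⟩
    have he : Function.Injective e := by
      intro q q' hqq'
      exact Subtype.ext (congrArg (fun x : L => (x : E3)) hqq')
    have h13 := ZLattice.summable_norm_sub_inv_pow L 13 (by rw [hL]; norm_num) p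
    have h7 := ZLattice.summable_norm_sub_inv_pow L 7 (by rw [hL]; norm_num) p
    have hg : Summable (fun q : T => (dist p q.1)⁻¹ ^ 13 + (dist p q.1)⁻¹ ^ 7) := by
      have := (h13.add h7).comp_injective he
      refine this.congr fun q => ?_
      show ‖(q.1 : E3) - p‖⁻¹ ^ 13 + ‖(q.1 : E3) - p‖⁻¹ ^ 7 = _
      rw [dist_comm, dist_eq_norm]
    exact Summable.of_norm_bounded hg fun q => norm_forceTerm_le (Ne.symm q.2.2)
  -- the point reflection as an involution of the index set
  have hmem : ∀ q : T, (2 : ℝ) • p - q.1 ∈ Sites a s z ∧ (2 : ℝ) • p - q.1 ≠ p := by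
    intro q
    have hq : q.1 ∈ L := hSub q.1 q.2.1
    refine ⟨?_, ?_⟩
    · apply hSub'
      rw [two_smul]
      exact L.sub_mem (L.add_mem hpL hpL) hq
    · intro h
      apply q.2.2
      calc q.1 = (2 : ℝ) • p - ((2 : ℝ) • p - q.1) := by rw [sub_sub_cancel]
        _ = (2 : ℝ) • p - p := by rw [h]
        _ = p := by rw [two_smul, add_sub_cancel_right]
  let σ : T ≃ T :=
    { toFun := fun q => ⟨(2 : ℝ) • p - q.1, hmem q⟩
      invFun := fun q => ⟨(2 : ℝ) • p - q.1, hmem q⟩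
      left_inv := fun q => Subtype.ext (by simp)
      right_inv := fun q => Subtype.ext (by simp) }
  obtain ⟨S, hS'⟩ := hsum
  have h1 : HasSum ((fun q : T => forceTerm p q.1) ∘ σ) S := (Equiv.hasSum_iff σ).2 hS'
  have heq : ((fun q : T => forceTerm p q.1) ∘ σ) = fun q : T => -forceTerm p q.1 := by
    funext q
    exact forceTerm_reflect p q.1
  rw [heq] at h1
  have h2 : HasSum (fun q : T => -forceTerm p q.1) (-S) := hS'.neg
  have hS0 : S = 0 := eq_zero_of_eq_neg_self (h1.unique h2)
  rwa [hS0] at hS'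


end Summit.AtomisticToContinuum.Crystallization.Theorems.UniformPolytypeStabilityNegative

end
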